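import Summits.QuantumAdvantage.QuantumAdvantage.Theorems.CubicForrelationNearExactIsExactSixteenDigits
import Summits.QuantumAdvantage.QuantumAdvantage.Theorems.CubicForrelationNearExactIsExactFourModSixPrep

/-!
# Crux `CubicForrelation.NearExactIsExact` (stmt-QuantumAdvantage-14043) — the MIXED-DIGIT Walsh tower on `n = 6r+4` bits (general `r`)

Certificate seat `b2b-cforr-cert` (gen 8).  HONEST FRAMING: preparatory lemmas, uniform in `r`, toward the statement that on `n ≡ 4 (mod 6)`
bits the SECOND dyadic boundary `1 − 2^{−⌊n/3⌋}` is not attained; infinitely many finite-slice verdicts, NOT summit progress.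

For a CUBIC `g : 𝔽₂^{(3r+2)+(3r+2)} → 𝔽₂` every Walsh value is a multiple of `2^{2r+2} = 2^{⌈n/3⌉}` (Ax/McEliece): `W_g = 2^{2r+2}·u`.
Writing the Euclidean binary digits `d₀ = u mod 2`, `d₁ = ⌊u/2⌋ mod 2`, `d₂ = ⌊u/4⌋ mod 2`, the Boolean functions `d₀, d₁, d₂` have
algebraic degree `≤ 1, ≤ 2, ≤ 4` (`f2_digitZero`, `f2_digitOne`, `f2_digitTwo`), with no hypothesis on the lower digits.  This is the tree's
`n = 16` file `…SixteenDigits.lean` (`sx_digitZero/One/Two`, itself the `n = 10` lemma six bits up) with `8 + 8` replaced by `(3r+2)+(3r+2)`: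
the cube-sum exponents `|I| + ⌈(n − |I|)/3⌉ − (2r+2)` depend only on `n mod 3`.  Also `f2_card_odd_of_split`: a non-constant affine
parity is balanced (`2^{6r+3}` odd values).

References: J. Ax, Amer. J. Math. 86 (1964); R. J. McEliece, Discrete Math. 3 (1972); C. Carlet, *Boolean Functions for Cryptography and
Coding Theory*, CUP 2021, §2.2 and §4.1.  Everything below is proved from Mathlib and the tree; axioms are the standard three.
-/

set_option linter.dupNamespace false -- D-0017: single-problem summit ⇒ `QuantumAdvantage.QuantumAdvantage` by design

noncomputable section

namespace Summit.QuantumAdvantage.QuantumAdvantage.Theorems.CubicForrelation.NearExactIsExact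

open Finset
open Literature.Computability.QuantumComplexity
open Literature.Computability.QuantumComplexity.DerivativeWalsh (W)

section FourModSixDigits

variable (r : ℕ) (g : (Fin ((3 * r + 2) + (3 * r + 2)) → Bool) → Bool) (u : (Fin ((3 * r + 2) + (3 * r + 2)) → Bool) → ℤ)

/-! ### Cube sums at the Ax level `2r+2` -/

/-- The cube sums of `u = W_g/2^{2r+2}` for a cubic `g` on `6r+4` bits: `2^{2r+2}·Σ_{E_I} u = 2^{|I|}·2^{⌈(n−|I|)/3⌉}·z` (Poisson over
`E_I`, Ax on `E_{Iᶜ}`). [cite: Carlet2020, §4.1] -/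
theorem f2_cube_sum (hg : IsDegLeFun 3 g) (hu : ∀ x, W (fun y => signOf (g y)) x = (2 : ℝ) ^ (2 * r + 2) * (u x : ℝ))
    (I : Finset (Fin ((3 * r + 2) + (3 * r + 2)))) :
    ∃ z : ℤ, (2 : ℤ) ^ (2 * r + 2) * ∑ x ∈ {x : Fin ((3 * r + 2) + (3 * r + 2)) → Bool | ∀ i, x i = true → i ∈ I}, u x =
      2 ^ #I * (2 ^ (((3 * r + 2) + (3 * r + 2) - #I + 2) / 3) * z) := by
  have hP := bb_poisson (fun y => signOf (g y)) I
  obtain ⟨z, hz⟩ := stub_axParity ((3 * r + 2) + (3 * r + 2)) 3 g Iᶜ (by norm_num) hg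
  have hj : #Iᶜ = (3 * r + 2) + (3 * r + 2) - #I := by rw [card_compl, Fintype.card_fin]
  rw [hj, show ((3 * r + 2) + (3 * r + 2) - #I + 3 - 1) / 3 = ((3 * r + 2) + (3 * r + 2) - #I + 2) / 3 by omega] at hz
  rw [sum_congr rfl fun x _ => hu x, ← mul_sum, hz] at hP
  refine ⟨z, ?_⟩
  have h' : (((2 : ℤ) ^ (2 * r + 2) * ∑ x ∈ {x : Fin ((3 * r + 2) + (3 * r + 2)) → Bool | ∀ i, x i = true → i ∈ I}, u x : ℤ) : ℝ) =
      (((2 : ℤ) ^ #I * (2 ^ (((3 * r + 2) + (3 * r + 2) - #I + 2) / 3) * z) : ℤ) : ℝ) := by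
    push_cast at hP ⊢
    linarith
  exact_mod_cast h'

/-! ### The three mixed digits on `6r+4` bits -/

/-- **Digit zero.** For cubic `g` on `6r+4` bits with `W_g = 2^{2r+2}·u`, the parity `x ↦ [u(x) odd]` is AFFINE (degree `≤ 1`):
the Ax-level step of the tower. [this work; cite: Carlet2020, §4.1 (McEliece)] -/
theorem f2_digitZero (hg : IsDegLeFun 3 g) (hu : ∀ x, W (fun y => signOf (g y)) x = (2 : ℝ) ^ (2 * r + 2) * (u x : ℝ)) :
    IsDegLeFun 1 (fun x => decide (Odd (u x))) :=
  stub_walshTower stub_axParity ((3 * r + 2) + (3 * r + 2)) (2 * r + 2) 1 g u hg hu (by intro k hk hkn; omega)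

/-- **Digit one.** For cubic `g` on `6r+4` bits with `W_g = 2^{2r+2}·u`, the Boolean function `x ↦ [⌊u(x)/2⌋ odd]` has algebraic
degree `≤ 2` (no assumption on the parity). [this work; cite: Carlet2020, §4.1 (McEliece) for the divisibility input] -/
theorem f2_digitOne (hg : IsDegLeFun 3 g) (hu : ∀ x, W (fun y => signOf (g y)) x = (2 : ℝ) ^ (2 * r + 2) * (u x : ℝ)) :
    IsDegLeFun 2 (fun x => decide (Odd (u x / 2))) := by
  have hP0 : IsDegLeFun 1 (fun x => decide (Odd (u x))) := f2_digitZero r g u hg hu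
  refine bb_moebius_isDegLeFun 2 _ fun I hI => ?_
  have hk : #I ≤ (3 * r + 2) + (3 * r + 2) := (card_le_univ I).trans_eq (Fintype.card_fin _)
  obtain ⟨z, hz⟩ := f2_cube_sum r g u hg hu I
  have h4 : (2 : ℤ) ^ 2 ∣ ∑ x ∈ {x : Fin ((3 * r + 2) + (3 * r + 2)) → Bool | ∀ i, x i = true → i ∈ I}, u x :=
    sx_dvd_of_balance (by omega) hz
  obtain ⟨z', hz'⟩ := td_count_cube (le_refl 1) (fun x => decide (Odd (u x))) hP0 I
  rw [show (#I + 1 - 1) / 1 = #I by simp] at hz'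
  have hA : (4 : ℤ) ∣ #{x : Fin ((3 * r + 2) + (3 * r + 2)) → Bool | (∀ i, x i = true → i ∈ I) ∧ decide (Odd (u x)) = true} := by
    obtain ⟨e, he⟩ : ∃ e, #I = e + 3 := ⟨#I - 3, by omega⟩
    rw [he, show (2 : ℤ) ^ (e + 3) = 2 ^ e * 8 by rw [pow_add]; norm_num] at hz'
    refine ⟨2 ^ e * (1 - z'), ?_⟩
    linarith
  have hsplit : ∑ x ∈ {x : Fin ((3 * r + 2) + (3 * r + 2)) → Bool | ∀ i, x i = true → i ∈ I}, u x =
      2 * ∑ x ∈ {x : Fin ((3 * r + 2) + (3 * r + 2)) → Bool | ∀ i, x i = true → i ∈ I}, u x / 2 +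
        #{x : Fin ((3 * r + 2) + (3 * r + 2)) → Bool | (∀ i, x i = true → i ∈ I) ∧ decide (Odd (u x)) = true} := by
    rw [sum_congr rfl fun x _ => td_two_mul_div_add (u x), sum_add_distrib, ← mul_sum, td_sum_ite_odd, filter_filter]
    simp only [decide_eq_true_eq]
  have hE : Even (∑ x ∈ {x : Fin ((3 * r + 2) + (3 * r + 2)) → Bool | ∀ i, x i = true → i ∈ I}, u x / 2) := by
    rw [pow_two] at h4
    obtain ⟨q, hq⟩ := h4
    obtain ⟨a, ha⟩ := hA
    refine ⟨q - a, ?_⟩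
    linarith
  have hE' := (tw_even_sum_iff _ (fun x => u x / 2)).1 hE
  rw [filter_filter] at hE'
  simpa only [decide_eq_true_eq] using hE'

/-- **Digit two.** For cubic `g` on `6r+4` bits with `W_g = 2^{2r+2}·u`, the Boolean function `x ↦ [⌊⌊u(x)/2⌋/2⌋ odd]` has algebraic
degree `≤ 4`. [this work; cite: Carlet2020, §4.1 (McEliece) for the divisibility input] -/
theorem f2_digitTwo (hg : IsDegLeFun 3 g) (hu : ∀ x, W (fun y => signOf (g y)) x = (2 : ℝ) ^ (2 * r + 2) * (u x : ℝ)) :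
    IsDegLeFun 4 (fun x => decide (Odd (u x / 2 / 2))) := by
  have hP0 : IsDegLeFun 1 (fun x => decide (Odd (u x))) := f2_digitZero r g u hg hu
  have hP1 := f2_digitOne r g u hg hu
  refine bb_moebius_isDegLeFun 4 _ fun I hI => ?_
  have hk : #I ≤ (3 * r + 2) + (3 * r + 2) := (card_le_univ I).trans_eq (Fintype.card_fin _)
  obtain ⟨z, hz⟩ := f2_cube_sum r g u hg hu I
  have h8 : (2 : ℤ) ^ 3 ∣ ∑ x ∈ {x : Fin ((3 * r + 2) + (3 * r + 2)) → Bool | ∀ i, x i = true → i ∈ I}, u x :=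
    sx_dvd_of_balance (by omega) hz
  obtain ⟨z', hz'⟩ := td_count_cube (le_refl 1) (fun x => decide (Odd (u x))) hP0 I
  rw [show (#I + 1 - 1) / 1 = #I by simp] at hz'
  have hA : (8 : ℤ) ∣ #{x : Fin ((3 * r + 2) + (3 * r + 2)) → Bool | (∀ i, x i = true → i ∈ I) ∧ decide (Odd (u x)) = true} := by
    obtain ⟨e, he⟩ : ∃ e, #I = e + 4 := ⟨#I - 4, by omega⟩
    rw [he, show (2 : ℤ) ^ (e + 4) = 2 ^ e * 16 by rw [pow_add]; norm_num] at hz'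
    refine ⟨2 ^ e * (1 - z'), ?_⟩
    linarith
  obtain ⟨z'', hz''⟩ := td_count_cube (by norm_num : 1 ≤ 2) (fun x => decide (Odd (u x / 2))) hP1 I
  have hB : (4 : ℤ) ∣ #{x : Fin ((3 * r + 2) + (3 * r + 2)) → Bool | (∀ i, x i = true → i ∈ I) ∧ decide (Odd (u x / 2)) = true} := by
    obtain ⟨e, he⟩ : ∃ e, #I = e + 5 := ⟨#I - 5, by omega⟩
    obtain ⟨e', he'⟩ : ∃ e', (#I + 2 - 1) / 2 = e' + 3 := ⟨(#I + 2 - 1) / 2 - 3, by omega⟩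
    rw [he', he, show (2 : ℤ) ^ (e + 5) = 2 ^ e * 32 by rw [pow_add]; norm_num,
      show (2 : ℤ) ^ (e' + 3) = 2 ^ e' * 8 by rw [pow_add]; norm_num] at hz''
    refine ⟨2 ^ e * 4 - 2 ^ e' * z'', ?_⟩
    linarith
  have hsplit : ∑ x ∈ {x : Fin ((3 * r + 2) + (3 * r + 2)) → Bool | ∀ i, x i = true → i ∈ I}, u x =
      2 * (2 * ∑ x ∈ {x : Fin ((3 * r + 2) + (3 * r + 2)) → Bool | ∀ i, x i = true → i ∈ I}, u x / 2 / 2 +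
        #{x : Fin ((3 * r + 2) + (3 * r + 2)) → Bool | (∀ i, x i = true → i ∈ I) ∧ decide (Odd (u x / 2)) = true}) +
        #{x : Fin ((3 * r + 2) + (3 * r + 2)) → Bool | (∀ i, x i = true → i ∈ I) ∧ decide (Odd (u x)) = true} := by
    rw [sum_congr rfl fun x _ => td_two_mul_div_add (u x), sum_add_distrib, ← mul_sum, td_sum_ite_odd, filter_filter,
      sum_congr rfl fun x _ => td_two_mul_div_add (u x / 2), sum_add_distrib, ← mul_sum, td_sum_ite_odd, filter_filter]
    simp only [decide_eq_true_eq]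
  have hE : Even (∑ x ∈ {x : Fin ((3 * r + 2) + (3 * r + 2)) → Bool | ∀ i, x i = true → i ∈ I}, u x / 2 / 2) := by
    obtain ⟨q, hq⟩ := h8
    obtain ⟨a, ha⟩ := hA
    obtain ⟨b, hb⟩ := hB
    refine ⟨q - a - b, ?_⟩
    have := hsplit
    rw [hq, ha, hb] at this
    linarith
  have hE' := (tw_even_sum_iff _ (fun x => u x / 2 / 2)).1 hE
  rw [filter_filter] at hE'
  simpa only [decide_eq_true_eq] using hE'

/-! ### Parseval and the size of the odd set -/

/-- Parseval at the Ax level, integer form: `W_g = 2^{2r+2}u ⇒ Σ_x u(x)² = 2^{8r+4}`. [folklore] -/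
theorem f2_sum_u_sq_int (hu : ∀ x, W (fun y => signOf (g y)) x = (2 : ℝ) ^ (2 * r + 2) * (u x : ℝ)) :
    ∑ x, u x ^ 2 = 2 ^ (8 * r + 4) := by
  have h := fms_sum_u_sq r g u hu
  exact_mod_cast h

/-- **A non-constant affine parity is balanced.** If the Ax-level parity `[u odd]` of a cubic `g` on `6r+4` bits takes both values, then
exactly `2^{6r+3}` of the `u(x)` are odd (Ax with `d = 1` on the full cube). [this work] -/
theorem f2_card_odd_of_split (hg : IsDegLeFun 3 g) (hu : ∀ x, W (fun y => signOf (g y)) x = (2 : ℝ) ^ (2 * r + 2) * (u x : ℝ))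
    (hodd : ∃ x, Odd (u x)) (heven : ∃ x, ¬ Odd (u x)) :
    #(univ.filter fun x : Fin ((3 * r + 2) + (3 * r + 2)) → Bool => Odd (u x)) = 2 ^ (6 * r + 3) := by
  obtain ⟨z, hz⟩ := td_count_cube (le_refl 1) (fun x => decide (Odd (u x))) (f2_digitZero r g u hg hu) univ
  rw [card_univ, Fintype.card_fin, show ((3 * r + 2) + (3 * r + 2) + 1 - 1) / 1 = 6 * r + 4 by omega] at hz
  have hset : ({x : Fin ((3 * r + 2) + (3 * r + 2)) → Bool | (∀ i, x i = true → i ∈ (univ : Finset (Fin ((3 * r + 2) + (3 * r + 2))))) ∧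
      decide (Odd (u x)) = true} : Finset _) = univ.filter fun x => Odd (u x) := by
    ext x
    simp
  rw [hset] at hz
  rw [show (2 : ℤ) ^ ((3 * r + 2) + (3 * r + 2)) = 2 ^ (6 * r + 4) by ring] at hz
  set A := #(univ.filter fun x : Fin ((3 * r + 2) + (3 * r + 2)) → Bool => Odd (u x)) with hA
  have hApos : 0 < A := by
    obtain ⟨x₀, hx₀⟩ := hodd
    exact card_pos.2 ⟨x₀, by simp [hx₀]⟩
  have hAlt : A < 2 ^ (6 * r + 4) := by
    obtain ⟨x₁, hx₁⟩ := heven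
    calc A < #(univ : Finset (Fin ((3 * r + 2) + (3 * r + 2)) → Bool)) := by
          apply card_lt_card
          exact (ssubset_iff_of_subset (filter_subset _ _)).2 ⟨x₁, mem_univ _, by simp [hx₁]⟩
      _ = 2 ^ (6 * r + 4) := by rw [card_univ, Fintype.card_fun, Fintype.card_bool, Fintype.card_fin]; ring
  have hA' : (A : ℤ) < 2 ^ (6 * r + 4) := by exact_mod_cast hAlt
  have hA'' : (0 : ℤ) < A := by exact_mod_cast hApos
  have hX : (0 : ℤ) < 2 ^ (6 * r + 4) := by positivity
  have hz0 : z = 0 := by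
    rcases lt_trichotomy z 0 with h | h | h
    · have : (2 : ℤ) ^ (6 * r + 4) * z ≤ 2 ^ (6 * r + 4) * (-1) := mul_le_mul_of_nonneg_left (by omega) hX.le
      linarith
    · exact h
    · have : (2 : ℤ) ^ (6 * r + 4) * 1 ≤ 2 ^ (6 * r + 4) * z := mul_le_mul_of_nonneg_left (by omega) hX.le
      linarith
  rw [hz0, mul_zero, sub_zero] at hz
  have : (A : ℤ) = 2 ^ (6 * r + 3) := by
    have e : (2 : ℤ) ^ (6 * r + 4) = 2 * 2 ^ (6 * r + 3) := by ring
    linarith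
  exact_mod_cast this

end FourModSixDigits

end Summit.QuantumAdvantage.QuantumAdvantage.Theorems.CubicForrelation.NearExactIsExact

end
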